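import Literature.MathematicalPhysics.QuantumManyBody.GroundStateFeynmanKacGaussian
import Literature.MathematicalPhysics.QuantumManyBody.GroundStateFeynmanKacSemigroup
import Mathlib.MeasureTheory.Function.L2Space
import Mathlib.Analysis.InnerProductSpace.Dual
import HarnessLib

/-!
# Ground-state Feynman–Kac: the semigroup as bounded operators on `L²(Λ_L^N)`

Topic `Literature/MathematicalPhysics/QuantumManyBody` (definition step of the proof of the named
fact `Literature.MathematicalPhysics.QuantumManyBody.BoseGas.GroundStateFeynmanKac`). The
Feynman–Kac functional `fkSemigroup v L t` of `GroundStateFeynmanKac.lean` acts on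
`[0, ∞]`-valued observables; the spectral theory (Perron–Frobenius for the compact self-adjoint
operator `e^{-tH_N}`, Chung–Zhao (1995) Thm 3.17, Reed–Simon IV Thm XIII.44) needs it as a
bounded linear operator on the real Hilbert space `L²(Λ_L^N, dX)`. This file provides:

* `fkReal v L t f X = E_X[w_t · f(B_t)]` — the Feynman–Kac functional of a REAL observable
  `f : (ℝ³)^N → ℝ` (Bochner integral of `weight × f(endpoint)`), i.e. `(e^{-tH_N} f)(X)`
  path-wise for signed `f`; for `f ≥ 0` it is `(fkSemigroup v L t (ofReal ∘ f) X).toReal`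
  (`fkReal_eq_toReal_fkSemigroup`);
* its basic analysis: it only sees `f` on the open box (`fkReal_indicator`), vanishes from
  outside the box, `‖fkReal f X‖ ≤ (e^{-tH}|f|)(X)` (`enorm_fkReal_le`), measurability in `X`,
  integrability of the integrand and linearity in `f` for `f ∈ L²(Λ^N)` (`t > 0`), insensitivity
  to null modifications (`t > 0`), the pointwise `L² → L^∞` bound and the **`L²` contraction**
  `∫_Λ (e^{-tH} f)² ≤ ∫_Λ f²` (`lintegral_enorm_fkReal_sq_le`: Cauchy–Schwarz in the killed path
  measure, then translation invariance of Lebesgue measure under the Gaussian displacement;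
  Chung–Zhao Thm 3.10 (27) `‖T_t‖_2 ≤ 1` for `q ≤ 0`);
* `fkL2 v L t : L²(Λ_L^N) →L[ℝ] L²(Λ_L^N)` — **the Feynman–Kac semigroup as a bounded operator**
  on `Lp ℝ 2 (volume.restrict (boxN N L))`, `(fkL2 v L t g)(X) = fkReal v L t g X` a.e.
  (`fkL2_coeFn`), of norm `≤ 1` (`norm_fkL2_le_one`); junk value `0` unless `v` is measurable and
  `t > 0` (the only regime used);
* `fkEval v L t X : L²(Λ_L^N) →L[ℝ] ℝ` — the bounded evaluation functional
  `g ↦ (e^{-tH_N} g)(X)` (`t > 0`; bounded by the `L² → L^∞` estimate of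
  `GroundStateFeynmanKacGaussian.lean`), whose Riesz vector is the kernel `u_t(X, ·) ∈ L²`
  (Chung–Zhao Thm 3.17 "`T_t` maps `L²` into `L^∞`/`C_b`").

## References

* K. L. Chung, Z. Zhao, *From Brownian Motion to Schrödinger's Equation* (1995), §3.2 Thm 3.10,
  §3.3 (3.34) and Thm 3.17. [ChungZhao1995]
* M. Reed, B. Simon, *Methods of Modern Mathematical Physics IV* (1978), §XIII.12.

## Design

The Hilbert space is `Lp ℝ 2 (volume.restrict (boxN N L))` (a finite measure), whose elements
are read through their canonical strongly measurable representatives `⇑g : (ℝ³)^N → ℝ`; since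
surviving world-lines end inside the open box, `fkReal` never looks at a representative outside
`Λ_L^N`, and for `t > 0` it does not see null modifications (the law of `B_t` is absolutely
continuous), so the operators are well defined on classes. No named fact is introduced.
-/

noncomputable section

namespace Literature.MathematicalPhysics.QuantumManyBody.BoseGas

open MeasureTheory ProbabilityTheory Filter Set
open scoped ENNReal NNReal Topology InnerProductSpace
open Literature.Probability.Process

variable {N : ℕ}

/-! ### The Feynman–Kac functional of a real observable -/

/-- **The Feynman–Kac functional of a real observable**:
`fkReal v L t f X = E_X[𝟙{τ > t} e^{-∫₀ᵗ ∑_{i<j} v(|Bⁱ_s - Bʲ_s|) ds} f(B_t)]`, the Dirichlet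
Schrödinger semigroup `(e^{-tH_N} f)(X)` evaluated path-wise on a signed observable
`f : (ℝ³)^N → ℝ` (Bochner integral of `weight × f(endpoint)` against `wienerPaths N`).
[cite: ChungZhao1995, §3.3 (3.34)] -/
def fkReal (v : ℝ → ℝ≥0∞) (L t : ℝ) (f : Config N → ℝ) (X : Config N) : ℝ :=
  ∫ ω, (fkWeight v L t X ω).toReal * f (worldLine X ω t.toNNReal) ∂wienerPaths N

/-- The functional only sees the observable on the open box (a surviving path ends in `Λ_L^N`,
a killed one has weight `0`). [folklore] -/
theorem fkReal_indicator (v : ℝ → ℝ≥0∞) (L : ℝ) {t : ℝ} (ht : 0 ≤ t) (f : Config N → ℝ)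
    (X : Config N) : fkReal v L t ((boxN N L).indicator f) X = fkReal v L t f X := by
  refine integral_congr_ae (Eventually.of_forall fun ω => ?_)
  by_cases hω : ω ∈ survives L t X
  · simp only [Set.indicator_of_mem (hω t ⟨ht, le_rfl⟩)]
  · simp [fkWeight, Set.indicator_of_notMem hω]

/-- The weight times the observable at the endpoint only sees the observable on the box
(pointwise in the sample). [folklore] -/
theorem fkWeight_mul_indicator (v : ℝ → ℝ≥0∞) (L : ℝ) {t : ℝ} (ht : 0 ≤ t) {β : Type*}
    [MulZeroClass β] (c : ℝ≥0∞ → β) (hc : c 0 = 0) (f : Config N → β) (X : Config N)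
    (ω : PathSpace N) :
    c (fkWeight v L t X ω) * (boxN N L).indicator f (worldLine X ω t.toNNReal) =
      c (fkWeight v L t X ω) * f (worldLine X ω t.toNNReal) := by
  by_cases hω : ω ∈ survives L t X
  · rw [Set.indicator_of_mem (hω t ⟨ht, le_rfl⟩)]
  · simp [fkWeight, Set.indicator_of_notMem hω, hc]

/-- From a starting point outside the open box the functional vanishes (`t ≥ 0`). [folklore] -/
theorem fkReal_of_notMem (v : ℝ → ℝ≥0∞) {L t : ℝ} (ht : 0 ≤ t) (f : Config N → ℝ)
    {X : Config N} (hX : X ∉ boxN N L) : fkReal v L t f X = 0 := by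
  simp [fkReal, fkWeight_of_notMem v ht hX]

/-- The `ℝ≥0∞`-norm of the real integrand is the `[0, ∞]`-weighted norm of the observable.
[folklore] -/
theorem enorm_fkIntegrand (v : ℝ → ℝ≥0∞) (L t : ℝ) (f : Config N → ℝ) (X : Config N)
    (ω : PathSpace N) :
    ‖(fkWeight v L t X ω).toReal * f (worldLine X ω t.toNNReal)‖ₑ =
      fkWeight v L t X ω * ‖f (worldLine X ω t.toNNReal)‖ₑ := by
  rw [enorm_mul, Real.enorm_of_nonneg ENNReal.toReal_nonneg,
    ENNReal.ofReal_toReal ((fkWeight_le_one v L t X ω).trans_lt ENNReal.one_lt_top).ne]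

/-- **`|e^{-tH} f| ≤ e^{-tH} |f|` pointwise**: `‖fkReal v L t f X‖ₑ ≤ fkSemigroup v L t ‖f‖ₑ X`.
[folklore] -/
theorem enorm_fkReal_le (v : ℝ → ℝ≥0∞) (L t : ℝ) (f : Config N → ℝ) (X : Config N) :
    ‖fkReal v L t f X‖ₑ ≤ fkSemigroup v L t (fun Y => ‖f Y‖ₑ) X := by
  refine (enorm_integral_le_lintegral_enorm _).trans (le_of_eq ?_)
  simp only [enorm_fkIntegrand]
  rfl

/-- The real integrand is measurable jointly in the starting point and the sample (measurable
`v`, `f`). [folklore] -/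
theorem measurable_fkIntegrand_uncurry {v : ℝ → ℝ≥0∞} (hv : Measurable v) (L t : ℝ)
    {f : Config N → ℝ} (hf : Measurable f) :
    Measurable fun p : Config N × PathSpace N =>
      (fkWeight v L t p.1 p.2).toReal * f (worldLine p.1 p.2 t.toNNReal) :=
  (measurable_fkWeight_uncurry hv L t).ennreal_toReal.mul
    (hf.comp (measurable_worldLine_uncurry' t.toNNReal))

/-- The real integrand is measurable in the sample. [folklore] -/
theorem measurable_fkIntegrand {v : ℝ → ℝ≥0∞} (hv : Measurable v) (L t : ℝ)
    {f : Config N → ℝ} (hf : Measurable f) (X : Config N) :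
    Measurable fun ω : PathSpace N =>
      (fkWeight v L t X ω).toReal * f (worldLine X ω t.toNNReal) :=
  (measurable_fkWeight hv L t X).ennreal_toReal.mul (hf.comp (measurable_worldLine X _))

/-- **Measurability of `X ↦ (e^{-tH_N} f)(X)`** for measurable `v` and `f`. [folklore] -/
@[fun_prop]
theorem measurable_fkReal {v : ℝ → ℝ≥0∞} (hv : Measurable v) (L t : ℝ) {f : Config N → ℝ}
    (hf : Measurable f) : Measurable (fkReal v L t f) :=
  ((measurable_fkIntegrand_uncurry hv L t hf).stronglyMeasurable.integral_prod_right'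
    (ν := wienerPaths N)).measurable

/-- For a nonnegative observable the real functional is the `[0, ∞]`-valued one, read in `ℝ`:
`fkReal v L t f X = (fkSemigroup v L t (ofReal ∘ f) X).toReal`. [folklore] -/
theorem fkReal_eq_toReal_fkSemigroup {v : ℝ → ℝ≥0∞} (hv : Measurable v) (L t : ℝ)
    {f : Config N → ℝ} (hf : Measurable f) (hf0 : ∀ Y, 0 ≤ f Y) (X : Config N) :
    fkReal v L t f X = (fkSemigroup v L t (fun Y => ENNReal.ofReal (f Y)) X).toReal := by
  rw [fkReal, integral_eq_lintegral_of_nonneg_ae (Eventually.of_forall fun ω =>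
      mul_nonneg ENNReal.toReal_nonneg (hf0 _))
    (measurable_fkIntegrand hv L t hf X).aestronglyMeasurable]
  congr 1
  refine lintegral_congr fun ω => ?_
  rw [ENNReal.ofReal_mul ENNReal.toReal_nonneg,
    ENNReal.ofReal_toReal ((fkWeight_le_one v L t X ω).trans_lt ENNReal.one_lt_top).ne]

/-! ### Integrability of the integrand and linearity, for `L²` observables (`t > 0`) -/

/-- The box-restricted squared `L²` mass of `f` is that of `𝟙_Λ f`. [folklore] -/
theorem lintegral_enorm_indicator_sq (L : ℝ) (f : Config N → ℝ) :
    ∫⁻ Y, ‖(boxN N L).indicator f Y‖ₑ ^ (2 : ℝ) = ∫⁻ Y in boxN N L, ‖f Y‖ₑ ^ (2 : ℝ) := by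
  rw [← lintegral_indicator (measurableSet_boxN N L)]
  refine lintegral_congr fun Y => ?_
  by_cases hY : Y ∈ boxN N L
  · simp [Set.indicator_of_mem hY]
  · simp [Set.indicator_of_notMem hY]

/-- The weighted functional of `|f|` is that of `|𝟙_Λ f|`. [folklore] -/
theorem fkSemigroup_enorm_indicator (v : ℝ → ℝ≥0∞) (L : ℝ) {t : ℝ} (ht : 0 ≤ t)
    (f : Config N → ℝ) (X : Config N) :
    fkSemigroup v L t (fun Y => ‖(boxN N L).indicator f Y‖ₑ) X =
      fkSemigroup v L t (fun Y => ‖f Y‖ₑ) X := by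
  simp_rw [enorm_indicator_eq_indicator_enorm]
  exact fkSemigroup_indicator v L ht _ X

/-- The `[0, ∞]`-weighted expectation of `|f|(B_t)` is finite for `f` square integrable on the
box (`t > 0`; `L² → L^∞` bound). [folklore] -/
theorem fkSemigroup_enorm_lt_top (v : ℝ → ℝ≥0∞) (L : ℝ) {t : ℝ} (ht : 0 < t)
    {f : Config N → ℝ} (hf : Measurable f)
    (hf2 : ∫⁻ Y in boxN N L, ‖f Y‖ₑ ^ (2 : ℝ) ≠ ⊤) (X : Config N) :
    fkSemigroup v L t (fun Y => ‖f Y‖ₑ) X < ⊤ := by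
  rw [← fkSemigroup_enorm_indicator v L ht.le f X]
  refine fkSemigroup_lt_top v L ht (hf.indicator (measurableSet_boxN N L)).enorm ?_ X
  rwa [lintegral_enorm_indicator_sq]

/-- **Integrability of the Feynman–Kac integrand** `ω ↦ w_t(X, ω) f(B_t)` for `f` measurable and
square integrable on the box, `t > 0`. [folklore] -/
theorem integrable_fkIntegrand {v : ℝ → ℝ≥0∞} (hv : Measurable v) (L : ℝ) {t : ℝ} (ht : 0 < t)
    {f : Config N → ℝ} (hf : Measurable f) (hf2 : ∫⁻ Y in boxN N L, ‖f Y‖ₑ ^ (2 : ℝ) ≠ ⊤)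
    (X : Config N) :
    Integrable (fun ω : PathSpace N =>
      (fkWeight v L t X ω).toReal * f (worldLine X ω t.toNNReal)) (wienerPaths N) := by
  refine ⟨(measurable_fkIntegrand hv L t hf X).aestronglyMeasurable, ?_⟩
  unfold HasFiniteIntegral
  simp only [enorm_fkIntegrand]
  exact fkSemigroup_enorm_lt_top v L ht hf hf2 X

/-- **Additivity** of the real functional (integrable integrands). [folklore] -/
theorem fkReal_add {v : ℝ → ℝ≥0∞} (hv : Measurable v) (L : ℝ) {t : ℝ} (ht : 0 < t)
    {f g : Config N → ℝ} (hf : Measurable f) (hg : Measurable g)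
    (hf2 : ∫⁻ Y in boxN N L, ‖f Y‖ₑ ^ (2 : ℝ) ≠ ⊤) (hg2 : ∫⁻ Y in boxN N L, ‖g Y‖ₑ ^ (2 : ℝ) ≠ ⊤)
    (X : Config N) : fkReal v L t (f + g) X = fkReal v L t f X + fkReal v L t g X := by
  simp only [fkReal, Pi.add_apply, mul_add]
  exact integral_add (integrable_fkIntegrand hv L ht hf hf2 X) (integrable_fkIntegrand hv L ht hg hg2 X)

/-- **Homogeneity** of the real functional. [folklore] -/
theorem fkReal_smul (v : ℝ → ℝ≥0∞) (L t : ℝ) (c : ℝ) (f : Config N → ℝ) (X : Config N) :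
    fkReal v L t (c • f) X = c * fkReal v L t f X := by
  simp only [fkReal, Pi.smul_apply, smul_eq_mul, ← integral_const_mul]
  refine integral_congr_ae (Eventually.of_forall fun ω => ?_)
  ring

/-- **Null modifications are invisible** (`t > 0`): if `f = g` a.e. then
`fkReal v L t f = fkReal v L t g` everywhere. [folklore] -/
theorem fkReal_congr_ae (v : ℝ → ℝ≥0∞) (L : ℝ) {t : ℝ} (ht : 0 < t) {f g : Config N → ℝ}
    (h : f =ᵐ[volume] g) (X : Config N) : fkReal v L t f X = fkReal v L t g X := by
  refine integral_congr_ae ?_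
  filter_upwards [comp_worldLine_ae_eq X (t := t.toNNReal) (by simpa using ht) h] with ω hω
  rw [hω]

/-- **Null modifications on the box are invisible** (`t > 0`): if `f = g` a.e. on `Λ_L^N` then
`fkReal v L t f = fkReal v L t g` everywhere. [folklore] -/
theorem fkReal_congr_ae_restrict (v : ℝ → ℝ≥0∞) (L : ℝ) {t : ℝ} (ht : 0 < t)
    {f g : Config N → ℝ} (h : f =ᵐ[volume.restrict (boxN N L)] g) (X : Config N) :
    fkReal v L t f X = fkReal v L t g X := by
  rw [← fkReal_indicator v L ht.le f, ← fkReal_indicator v L ht.le g]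
  refine fkReal_congr_ae v L ht ?_ X
  have h' := (ae_restrict_iff' (measurableSet_boxN N L)).1 h
  filter_upwards [h'] with Y hY
  by_cases hYD : Y ∈ boxN N L
  · simp [Set.indicator_of_mem hYD, hY hYD]
  · simp [Set.indicator_of_notMem hYD]

/-! ### The pointwise `L² → L^∞` bound and the `L²` contraction -/

/-- **Pointwise `L² → L^∞` bound**: for `t > 0`,
`‖(e^{-tH_N} f)(X)‖ ≤ (4πt)^{-3N/4} ‖f‖_{L²(Λ)}`, uniformly in `X`. Chung–Zhao (1995), Thm 3.17.
[cite: ChungZhao1995, Thm 3.17] -/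
theorem enorm_fkReal_le_L2 (v : ℝ → ℝ≥0∞) (L : ℝ) {t : ℝ} (ht : 0 < t) {f : Config N → ℝ}
    (hf : Measurable f) (X : Config N) :
    ‖fkReal v L t f X‖ₑ ≤
      (∏ _i : Fin N, ∏ _k : Fin 3, ENNReal.ofReal (Real.sqrt (2 * Real.pi * (2 * t.toNNReal)))⁻¹) ^
          (1 / 2 : ℝ) * (∫⁻ Y in boxN N L, ‖f Y‖ₑ ^ (2 : ℝ)) ^ (1 / 2 : ℝ) := by
  rw [← fkReal_indicator v L ht.le f]
  refine (enorm_fkReal_le v L t _ X).trans ?_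
  rw [← lintegral_enorm_indicator_sq L f]
  exact fkSemigroup_le_L2 v L ht (hf.indicator (measurableSet_boxN N L)).enorm X

/-- **Cauchy–Schwarz in the killed path measure**: `(E_X[w F(B_t)])² ≤ E_X[w F(B_t)²]`
(`E_X[w] = Z_t(X) ≤ 1`), for measurable `F ≥ 0`. [folklore] -/
theorem lintegral_fkWeight_mul_sq_le {v : ℝ → ℝ≥0∞} (hv : Measurable v) (L t : ℝ)
    {F : Config N → ℝ≥0∞} (hF : Measurable F) (X : Config N) :
    (∫⁻ ω, fkWeight v L t X ω * F (worldLine X ω t.toNNReal) ∂wienerPaths N) ^ (2 : ℝ) ≤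
      ∫⁻ ω, fkWeight v L t X ω * F (worldLine X ω t.toNNReal) ^ (2 : ℝ) ∂wienerPaths N := by
  have hFm : AEMeasurable (fun ω => F (worldLine X ω t.toNNReal)) (fkPathMeasure v L t X) :=
    (hF.comp (measurable_worldLine X _)).aemeasurable
  have h1 := ENNReal.lintegral_mul_le_Lp_mul_Lq (fkPathMeasure v L t X)
    Real.HolderConjugate.two_two (f := fun _ => 1)
    (g := fun ω => F (worldLine X ω t.toNNReal)) aemeasurable_const hFm
  rw [← lintegral_fkPathMeasure hv, ← lintegral_fkPathMeasure hv]
  have hZ : (∫⁻ _ω, (1 : ℝ≥0∞) ^ (2 : ℝ) ∂fkPathMeasure v L t X) ^ (1 / (2 : ℝ)) ≤ 1 := by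
    simp only [ENNReal.one_rpow, lintegral_const, one_mul]
    refine ENNReal.rpow_le_one ?_ (by norm_num)
    rw [fkPathMeasure_univ]
    exact fkPartition_le_one v L t X
  simp only [Pi.mul_apply, one_mul] at h1
  have h2 : ∫⁻ ω, F (worldLine X ω t.toNNReal) ∂fkPathMeasure v L t X ≤
      (∫⁻ ω, F (worldLine X ω t.toNNReal) ^ (2 : ℝ) ∂fkPathMeasure v L t X) ^ (1 / (2 : ℝ)) :=
    h1.trans (mul_le_of_le_one_left bot_le hZ)
  calc (∫⁻ ω, F (worldLine X ω t.toNNReal) ∂fkPathMeasure v L t X) ^ (2 : ℝ)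
      ≤ ((∫⁻ ω, F (worldLine X ω t.toNNReal) ^ (2 : ℝ) ∂fkPathMeasure v L t X) ^ (1 / (2 : ℝ))) ^
          (2 : ℝ) := ENNReal.rpow_le_rpow h2 (by norm_num)
    _ = _ := by rw [← ENNReal.rpow_mul]; norm_num

/-- **Pointwise square bound**: `‖(e^{-tH} f)(X)‖² ≤ E_X[w_t f(B_t)²]`. [folklore] -/
theorem enorm_fkReal_sq_le {v : ℝ → ℝ≥0∞} (hv : Measurable v) (L t : ℝ) {f : Config N → ℝ}
    (hf : Measurable f) (X : Config N) :
    ‖fkReal v L t f X‖ₑ ^ (2 : ℝ) ≤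
      ∫⁻ ω, fkWeight v L t X ω * ‖f (worldLine X ω t.toNNReal)‖ₑ ^ (2 : ℝ) ∂wienerPaths N :=
  (ENNReal.rpow_le_rpow (enorm_fkReal_le v L t f X) (by norm_num)).trans
    (lintegral_fkWeight_mul_sq_le hv L t hf.enorm X)

/-- **The `L²` contraction** `∫ ‖e^{-tH_N} f‖² dX ≤ ∫ ‖f‖² dX` (whole space): Cauchy–Schwarz
in the killed path measure, Tonelli, the weight bound `w ≤ 1` and translation invariance of
Lebesgue measure under the Gaussian displacement `B_t = X + √2 b_t`. Chung–Zhao (1995),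
Thm 3.10 (27) (`‖T_t‖_2 ≤ e^{C₀+C₁t}`, here `q = -V ≤ 0`). [cite: ChungZhao1995, Thm 3.10] -/
theorem lintegral_enorm_fkReal_sq_le {v : ℝ → ℝ≥0∞} (hv : Measurable v) (L t : ℝ)
    {f : Config N → ℝ} (hf : Measurable f) :
    ∫⁻ X, ‖fkReal v L t f X‖ₑ ^ (2 : ℝ) ≤ ∫⁻ Y, ‖f Y‖ₑ ^ (2 : ℝ) := by
  have hm : Measurable (Function.uncurry fun (X : Config N) (ω : PathSpace N) =>
      fkWeight v L t X ω * ‖f (worldLine X ω t.toNNReal)‖ₑ ^ (2 : ℝ)) :=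
    (measurable_fkWeight_uncurry hv L t).mul
      ((hf.comp (measurable_worldLine_uncurry' t.toNNReal)).enorm.pow_const _)
  calc ∫⁻ X, ‖fkReal v L t f X‖ₑ ^ (2 : ℝ)
      ≤ ∫⁻ X, ∫⁻ ω, fkWeight v L t X ω * ‖f (worldLine X ω t.toNNReal)‖ₑ ^ (2 : ℝ)
          ∂wienerPaths N := lintegral_mono fun X => enorm_fkReal_sq_le hv L t hf X
    _ = ∫⁻ ω, ∫⁻ X, fkWeight v L t X ω * ‖f (worldLine X ω t.toNNReal)‖ₑ ^ (2 : ℝ)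
          ∂volume ∂wienerPaths N := lintegral_lintegral_swap hm.aemeasurable
    _ ≤ ∫⁻ ω, ∫⁻ X, ‖f (worldLine X ω t.toNNReal)‖ₑ ^ (2 : ℝ) ∂volume ∂wienerPaths N := by
        refine lintegral_mono fun ω => lintegral_mono fun X => ?_
        calc fkWeight v L t X ω * ‖f (worldLine X ω t.toNNReal)‖ₑ ^ (2 : ℝ)
            ≤ 1 * ‖f (worldLine X ω t.toNNReal)‖ₑ ^ (2 : ℝ) :=
              mul_le_mul' (fkWeight_le_one v L t X ω) le_rfl
          _ = _ := one_mul _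
    _ = ∫⁻ _ω, ∫⁻ Y, ‖f Y‖ₑ ^ (2 : ℝ) ∂volume ∂wienerPaths N := by
        refine lintegral_congr fun ω => ?_
        exact lintegral_add_right_eq_self (μ := (volume : Measure (Config N)))
          (fun Y => ‖f Y‖ₑ ^ (2 : ℝ)) _
    _ = ∫⁻ Y, ‖f Y‖ₑ ^ (2 : ℝ) := by
        rw [lintegral_const, measure_univ, mul_one]

/-- **The `L²(Λ)` contraction**: `∫_Λ ‖e^{-tH_N} f‖² ≤ ∫_Λ ‖f‖²` (`t ≥ 0`). [folklore] -/
theorem setLIntegral_enorm_fkReal_sq_le {v : ℝ → ℝ≥0∞} (hv : Measurable v) (L : ℝ) {t : ℝ}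
    (ht : 0 ≤ t) {f : Config N → ℝ} (hf : Measurable f) :
    ∫⁻ X in boxN N L, ‖fkReal v L t f X‖ₑ ^ (2 : ℝ) ≤ ∫⁻ Y in boxN N L, ‖f Y‖ₑ ^ (2 : ℝ) := by
  calc ∫⁻ X in boxN N L, ‖fkReal v L t f X‖ₑ ^ (2 : ℝ)
      ≤ ∫⁻ X, ‖fkReal v L t f X‖ₑ ^ (2 : ℝ) := setLIntegral_le_lintegral _ _
    _ = ∫⁻ X, ‖fkReal v L t ((boxN N L).indicator f) X‖ₑ ^ (2 : ℝ) := by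
        simp_rw [fkReal_indicator v L ht]
    _ ≤ ∫⁻ Y, ‖(boxN N L).indicator f Y‖ₑ ^ (2 : ℝ) :=
        lintegral_enorm_fkReal_sq_le hv L t (hf.indicator (measurableSet_boxN N L))
    _ = ∫⁻ Y in boxN N L, ‖f Y‖ₑ ^ (2 : ℝ) := lintegral_enorm_indicator_sq L f

/-! ### `L²(Λ_L^N)` and the operators -/

/-- The squared `L²(Λ)` mass as the square of the `eLpNorm`. [folklore] -/
theorem eLpNorm_two_eq (L : ℝ) (f : Config N → ℝ) :
    eLpNorm f 2 (volume.restrict (boxN N L)) =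
      (∫⁻ Y in boxN N L, ‖f Y‖ₑ ^ (2 : ℝ)) ^ (1 / 2 : ℝ) := by
  rw [eLpNorm_eq_lintegral_rpow_enorm_toReal two_ne_zero ENNReal.ofNat_ne_top]
  norm_num

/-- An `L²(Λ)` class has finite squared mass on the box. [folklore] -/
theorem setLIntegral_enorm_sq_ne_top {L : ℝ} (g : Lp ℝ 2 (volume.restrict (boxN N L))) :
    ∫⁻ Y in boxN N L, ‖g Y‖ₑ ^ (2 : ℝ) ≠ ⊤ := by
  have h := Lp.eLpNorm_lt_top g
  rw [eLpNorm_two_eq] at h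
  intro htop
  rw [htop, ENNReal.top_rpow_of_pos (by norm_num)] at h
  exact lt_irrefl _ h

/-- The canonical representative of an `L²(Λ)` class is measurable. [folklore] -/
theorem measurable_coeFn_Lp {L : ℝ} (g : Lp ℝ 2 (volume.restrict (boxN N L))) :
    Measurable (g : Config N → ℝ) :=
  (Lp.stronglyMeasurable g).measurable

/-- **`e^{-tH_N}` maps `L²(Λ)` to `L²(Λ)`**: for `t > 0` and an `L²(Λ)` class `g`,
`fkReal v L t g ∈ L²(Λ)` with `eLpNorm ≤ eLpNorm g`. [folklore] -/
theorem memLp_fkReal {v : ℝ → ℝ≥0∞} (hv : Measurable v) (L : ℝ) {t : ℝ} (ht : 0 < t)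
    (g : Lp ℝ 2 (volume.restrict (boxN N L))) :
    MemLp (fkReal v L t g) 2 (volume.restrict (boxN N L)) := by
  refine ⟨(measurable_fkReal hv L t (measurable_coeFn_Lp g)).aestronglyMeasurable, ?_⟩
  rw [eLpNorm_two_eq]
  refine ENNReal.rpow_lt_top_of_nonneg (by norm_num) (ne_of_lt ?_)
  exact (setLIntegral_enorm_fkReal_sq_le hv L ht.le (measurable_coeFn_Lp g)).trans_lt
    (lt_top_iff_ne_top.2 (setLIntegral_enorm_sq_ne_top g))

/-- The `eLpNorm` bound `‖e^{-tH} g‖_{L²(Λ)} ≤ ‖g‖_{L²(Λ)}`. [folklore] -/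
theorem eLpNorm_fkReal_le {v : ℝ → ℝ≥0∞} (hv : Measurable v) (L : ℝ) {t : ℝ} (ht : 0 ≤ t)
    (g : Lp ℝ 2 (volume.restrict (boxN N L))) :
    eLpNorm (fkReal v L t g) 2 (volume.restrict (boxN N L)) ≤
      eLpNorm (g : Config N → ℝ) 2 (volume.restrict (boxN N L)) := by
  rw [eLpNorm_two_eq, eLpNorm_two_eq]
  exact ENNReal.rpow_le_rpow (setLIntegral_enorm_fkReal_sq_le hv L ht (measurable_coeFn_Lp g))
    (by norm_num)

/-- Additivity of `fkReal` on `L²(Λ)` classes (`t > 0`). [folklore] -/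
theorem fkReal_coeFn_add {v : ℝ → ℝ≥0∞} (hv : Measurable v) (L : ℝ) {t : ℝ} (ht : 0 < t)
    (g g' : Lp ℝ 2 (volume.restrict (boxN N L))) :
    fkReal v L t (⇑(g + g')) = fkReal v L t g + fkReal v L t g' := by
  funext X
  rw [fkReal_congr_ae_restrict v L ht (Lp.coeFn_add g g') X, Pi.add_apply]
  exact fkReal_add hv L ht (measurable_coeFn_Lp g) (measurable_coeFn_Lp g')
    (setLIntegral_enorm_sq_ne_top g) (setLIntegral_enorm_sq_ne_top g') X

/-- Homogeneity of `fkReal` on `L²(Λ)` classes (`t > 0`). [folklore] -/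
theorem fkReal_coeFn_smul {v : ℝ → ℝ≥0∞} (L : ℝ) {t : ℝ} (ht : 0 < t) (c : ℝ)
    (g : Lp ℝ 2 (volume.restrict (boxN N L))) :
    fkReal v L t (⇑(c • g)) = c • fkReal v L t g := by
  funext X
  rw [fkReal_congr_ae_restrict v L ht (Lp.coeFn_smul c g) X, Pi.smul_apply, smul_eq_mul]
  exact fkReal_smul v L t c g X

/-- **The Feynman–Kac semigroup as a bounded operator on `L²(Λ_L^N)`**:
`fkL2 v L t : L²(Λ_L^N) →L[ℝ] L²(Λ_L^N)`, `g ↦ [X ↦ (e^{-tH_N} g)(X)] = fkReal v L t g` (as an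
`L²` class), the Dirichlet Schrödinger semigroup `e^{-tH_N}` of
`H_N = -∑Δᵢ + ∑_{i<j} v(|xᵢ-xⱼ|)` on `Λ_L^N` realised path-wise (Chung–Zhao's `T_t` on the
appropriate space `L²(D)`). **Junk value** `0` unless `v` is measurable and `t > 0`.
[cite: ChungZhao1995, Thm 3.17] -/
def fkL2 (v : ℝ → ℝ≥0∞) (L t : ℝ) :
    Lp ℝ 2 (volume.restrict (boxN N L)) →L[ℝ] Lp ℝ 2 (volume.restrict (boxN N L)) :=
  open Classical in
  if h : Measurable v ∧ 0 < t then
    LinearMap.mkContinuous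
      { toFun := fun g => (memLp_fkReal h.1 L h.2 g).toLp (fkReal v L t g)
        map_add' := fun g g' => by
          rw [← MemLp.toLp_add (memLp_fkReal h.1 L h.2 g) (memLp_fkReal h.1 L h.2 g')]
          exact MemLp.toLp_congr _ _ (Eventually.of_forall fun X => by
            rw [fkReal_coeFn_add h.1 L h.2 g g'])
        map_smul' := fun c g => by
          rw [RingHom.id_apply, ← MemLp.toLp_const_smul c (memLp_fkReal h.1 L h.2 g)]
          exact MemLp.toLp_congr _ _ (Eventually.of_forall fun X => by
            rw [fkReal_coeFn_smul L h.2 c g]) }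
      1 (fun g => by
        simp only [LinearMap.coe_mk, AddHom.coe_mk, one_mul, Lp.norm_toLp]
        rw [Lp.norm_def]
        exact ENNReal.toReal_mono (Lp.eLpNorm_ne_top g) (eLpNorm_fkReal_le h.1 L h.2.le g))
  else 0

/-- **`fkL2` acts by `fkReal`**: for measurable `v` and `t > 0`,
`(fkL2 v L t g)(X) = fkReal v L t g X` for a.e. `X ∈ Λ_L^N`. [folklore] -/
theorem fkL2_coeFn {v : ℝ → ℝ≥0∞} (hv : Measurable v) (L : ℝ) {t : ℝ} (ht : 0 < t)
    (g : Lp ℝ 2 (volume.restrict (boxN N L))) :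
    (fkL2 v L t g : Config N → ℝ) =ᵐ[volume.restrict (boxN N L)] fkReal v L t g := by
  have h : Measurable v ∧ 0 < t := ⟨hv, ht⟩
  simp only [fkL2, dif_pos h, LinearMap.mkContinuous_apply, LinearMap.coe_mk, AddHom.coe_mk]
  exact MemLp.coeFn_toLp _

/-- `fkL2 v L t g` is the `L²` class of `fkReal v L t g`. [folklore] -/
theorem fkL2_apply {v : ℝ → ℝ≥0∞} (hv : Measurable v) (L : ℝ) {t : ℝ} (ht : 0 < t)
    (g : Lp ℝ 2 (volume.restrict (boxN N L))) :
    fkL2 v L t g = (memLp_fkReal hv L ht g).toLp (fkReal v L t g) := by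
  have h : Measurable v ∧ 0 < t := ⟨hv, ht⟩
  simp only [fkL2, dif_pos h, LinearMap.mkContinuous_apply, LinearMap.coe_mk, AddHom.coe_mk]

/-- **`‖e^{-tH_N}‖_{L²(Λ) → L²(Λ)} ≤ 1`** (contraction). Chung–Zhao (1995), Thm 3.10 (27).
[cite: ChungZhao1995, Thm 3.10] -/
theorem norm_fkL2_le_one (v : ℝ → ℝ≥0∞) (L t : ℝ) : ‖(fkL2 v L t :
    Lp ℝ 2 (volume.restrict (boxN N L)) →L[ℝ] Lp ℝ 2 (volume.restrict (boxN N L)))‖ ≤ 1 := by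
  unfold fkL2
  split_ifs with h
  · exact LinearMap.mkContinuous_norm_le _ zero_le_one _
  · simp

/-- **The evaluation functional `g ↦ (e^{-tH_N} g)(X)` on `L²(Λ_L^N)`** is bounded
(`L² → L^∞` estimate, `t > 0`): `fkEval v L t X g = fkReal v L t g X`. Its Riesz vector is the
kernel `u_t(X, ·)` (Chung–Zhao (1995), Thm 3.17: `T_t : L²(D) → L^∞(D)`). **Junk value** `0`
unless `v` is measurable and `t > 0`. [cite: ChungZhao1995, Thm 3.17] -/
def fkEval (v : ℝ → ℝ≥0∞) (L t : ℝ) (X : Config N) :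
    Lp ℝ 2 (volume.restrict (boxN N L)) →L[ℝ] ℝ :=
  open Classical in
  if h : Measurable v ∧ 0 < t then
    LinearMap.mkContinuous
      { toFun := fun g => fkReal v L t g X
        map_add' := fun g g' => by
          have := congrFun (fkReal_coeFn_add h.1 L h.2 g g') X
          simpa using this
        map_smul' := fun c g => by
          have := congrFun (fkReal_coeFn_smul (v := v) L h.2 c g) X
          simpa using this }
      ((∏ _i : Fin N, ∏ _k : Fin 3,
        ENNReal.ofReal (Real.sqrt (2 * Real.pi * (2 * t.toNNReal)))⁻¹) ^ (1 / 2 : ℝ)).toReal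
      (fun g => by
        simp only [LinearMap.coe_mk, AddHom.coe_mk, Lp.norm_def, eLpNorm_two_eq]
        rw [← ENNReal.toReal_mul, Real.norm_eq_abs, ← ENNReal.toReal_ofReal (abs_nonneg _),
          ← Real.enorm_eq_ofReal_abs]
        refine ENNReal.toReal_mono (ENNReal.mul_ne_top ?_ ?_)
          (enorm_fkReal_le_L2 v L h.2 (measurable_coeFn_Lp g) X)
        · refine ENNReal.rpow_ne_top_of_nonneg (by norm_num) (ne_of_lt ?_)
          exact ENNReal.prod_lt_top fun i _ => ENNReal.prod_lt_top fun k _ => ENNReal.ofReal_lt_top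
        · exact ENNReal.rpow_ne_top_of_nonneg (by norm_num) (setLIntegral_enorm_sq_ne_top g))
  else 0

/-- **`fkEval` is evaluation of `fkReal`** (measurable `v`, `t > 0`). [folklore] -/
@[simp] theorem fkEval_apply {v : ℝ → ℝ≥0∞} (hv : Measurable v) (L : ℝ) {t : ℝ} (ht : 0 < t)
    (X : Config N) (g : Lp ℝ 2 (volume.restrict (boxN N L))) :
    fkEval v L t X g = fkReal v L t g X := by
  have h : Measurable v ∧ 0 < t := ⟨hv, ht⟩
  simp only [fkEval, dif_pos h, LinearMap.mkContinuous_apply, LinearMap.coe_mk, AddHom.coe_mk]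

/-- The evaluation functionals and the operator: `fkEval v L t X g = (fkL2 v L t g)(X)` for
a.e. `X ∈ Λ`. [folklore] -/
theorem fkL2_coeFn_eq_fkEval {v : ℝ → ℝ≥0∞} (hv : Measurable v) (L : ℝ) {t : ℝ} (ht : 0 < t)
    (g : Lp ℝ 2 (volume.restrict (boxN N L))) :
    (fkL2 v L t g : Config N → ℝ) =ᵐ[volume.restrict (boxN N L)] fun X => fkEval v L t X g := by
  filter_upwards [fkL2_coeFn hv L ht g] with X hX
  rw [hX, fkEval_apply hv L ht]

end Literature.MathematicalPhysics.QuantumManyBody.BoseGas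

end
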